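import Literature.AnabelianGeometry.EtaleTheta.Discharge.Sec5Thm57KummerTorsionOfEtaleTower

/-!
# [EtTh] §5, Theorem 5.7 (C)-chain: the FAMILY form — the whole `htorsfam` binder of the '_final_v6' knits from the member-free étale
# residual list + Thm. 5.6 at each member, in ONE term (pp. 324–331, 291 / PDF pp. 98–105, 65)

Mochizuki, *The étale theta function and its Frobenioid-theoretic manifestations*, Publ. RIMS **45** (2009)
[cite: MochizukiEtTh2009, Thm 5.7 proof p.330 (PDF p.104); Thm 5.6 p.328 (PDF p.102); Prop 5.2 (iii) p.324 (PDF p.98); Cor 2.19 (iii)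
p.291 (PDF p.65); Lem 5.8 p.331 (PDF p.105)].  Seat abc-iut-w6-d049 (gen 5; node `EtTh:Thm5.7`, abc-iut-L2-lead (gen 6) R798/R808 (e2)/(e3)).
PROOF-ONLY (0 definitions) over this seat's `Sec5Thm57KummerTorsionOfEtaleTower.lean` (p478416); nothing landed is edited or restated.

THE POINT.  abc-iut-f-123's FINAL KNIT v6 and its Setting twins (`Sec5Thm57FinalKnitV6.lean` p476561, `…OfThetaSetting.lean`,
`…OfThetaSettingNonDilating.lean`) display the (C) residual of Thm. 5.7 as ONE binder `htorsfam` with a fixed quantifier prefix (constant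
normalised anchor `(α₁, β₁, u₁, c)`, every level `N ∈ E`, every family member `(a, b, w)` with its four transport / coherence equations).
`ThetaFrobenioidTower.kummerTorsion_family_of_etaleTower` produces EXACTLY that binder (generic `(𝔗, Ψ, 𝒯)`, `𝔗`-currency) from the
member-free étale residual list of p478416 — dictionary at every level (`ι`, `hι`, `m_M`, `CyclotomicCharacterCompat`, `Facts`, pins of a
COMPATIBLE family `η`), `(γ, γ_μ)` with `hstd` = VERBATIM the conclusion shape of `MuTwoSetting.Cor219_iii_std` (F-0652), glue, `hinfη`
(translation-freeness in pure étale currency), `hsep` (separation across levels) — and `hK4fam` (Thm. 5.6 at each member: base shadow with its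
laws and (K4m) at `γ_μ`, quantified exactly like `htorsfam`).  Hence any such knit substitutes its (C) binder by the single term
`𝔗.kummerTorsion_family_of_etaleTower Ψ 𝒯 ι hι m hχ H η hη hηc hpin γ hγ hγ' γμ hstd hγμχ hγμred haug hinfη hsep hK4fam` — done for the
plain Setting twin in `Sec5Thm57FinalKnitV6OfThetaSettingOfEtale.lean` (p480505) and the canonical-vocabulary twin in
`Sec5Thm57FinalKnitV6OfThetaSettingNonDilatingOfEtale.lean` (p481337); for the weak-vocabulary twin
`thetaRootPreservedAll_ofThetaSettingYddFamily_final_v6_treeMonoidVocabWeak_of_cor218_i` the same one-term substitution elaborates (farm rc 0,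
this seat's staging) but is not filed separately (the gate identifies its statement with the canonical twin's).
HONEST FRAMING: kernel-checked composition; none of the displayed binders is proved here or asserted to hold at any model; nothing of [EtTh] is
asserted unconditionally; typed ≠ discharged; no side taken on anything downstream ([IUTchIII] Cor. 3.12 in particular).
-/

namespace Literature.AnabelianGeometry.EtaleTheta

open CategoryTheory
open Literature.AlgebraicGeometry.Frobenioids

namespace ThetaFrobenioidTower

section FamilyGeneric

universe w v v' u u'

variable {C : Type u} [Category.{v} C] {D : Type u'} [Category.{v'} D] (𝔗 : ThetaFrobenioidTower.{w} C D)
  (Ψ : C ≌ C) {E : Set ℕ+} (𝒯 : ThetaEnvTower.{v} E)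

/-- **The FAMILY form of `kummerTorsion_of_etaleTower` (p478416)** — generic over `(𝔗, Ψ, 𝒯)`: the whole `htorsfam` binder of abc-iut-f-123's
'_final_v6' knits (constant normalised anchor, every level `N ∈ E`, every family member `(a, b, w)` with its four transport / coherence equations)
from the member-free étale residual list + Thm. 5.6 at each member (`hK4fam`, quantified exactly like `htorsfam`).  The member's equations are
re-read in the `(e, D_c, D_p) := (refl, 1, w)` shape of p458762 / p473560.
[cite: MochizukiEtTh2009, Thm 5.7 proof p.330 (PDF p.104); Thm 5.6 p.328 (PDF p.102); Cor 2.19 (iii) p.291 (PDF p.65)] -/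
theorem kummerTorsion_family_of_etaleTower
    (ι : 𝔗.PiX ≃* 𝒯.PiX) (hι : ∀ y : 𝔗.PiX, y ∈ 𝔗.PiYdd ↔ ι y ∈ 𝒯.PiYdd)
    (m : ∀ M : E, (𝔗.atLevel M).muTorsion (𝔗.atLevel M).BN (𝔗.atLevel M).N ≃* (𝒯.level M).mu)
    (hχ : ∀ M : E, (𝔗.atLevel M).CyclotomicCharacterCompat (𝒯.level M) ι (m M))
    (H : ∀ M : E, (𝔗.atLevel M).Facts)
    (η : ∀ M : E, 𝒯.PiYdd → 𝒯.mu M) (hη : ∀ M, η M ∈ 𝒯.thetaCocycles M)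
    (hηc : ∀ (M M' : E) (h : (M : ℕ+) ∣ M'), 𝒯.red M M' h ∘ η M' = η M)
    (hpin : ∀ M : E, (𝔗.atLevel M).ThetaSectionCompat (H M) (𝒯.level M) ι (m M) hι (η M))
    (γ : 𝒯.PiX ≃ₜ* 𝒯.PiX) (hγ : 𝒯.PiYdd.map γ.toMulEquiv.toMonoidHom = 𝒯.PiYdd)
    (hγ' : ∀ x : 𝒯.PiX, x ∈ 𝒯.PiYdd → γ x ∈ 𝒯.PiYdd) (γμ : ∀ M : E, 𝒯.mu M ≃* 𝒯.mu M)
    (hstd : ∃ cf : ∀ M : E, 𝒯.G → 𝒯.mu M,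
      (∀ M, CycEnvelope.IsEnvCocycle (MonoidHom.id 𝒯.G) (𝒯.chi M) (cf M)) ∧
      (∀ M, IsLocallyConstant (cf M ∘ 𝒯.aug)) ∧
      (∀ (M M' : E) (h : (M : ℕ+) ∣ M'), 𝒯.red M M' h ∘ cf M' = cf M) ∧
      (∀ M, 𝒯.pullbackCocycle M γ hγ (γμ M) '' 𝒯.thetaCocycles M =
        (fun η => η * (cf M ∘ 𝒯.aug ∘ 𝒯.PiYdd.subtype)) '' 𝒯.thetaCocycles M) ∧
      ∀ M : E, ∃ d : 𝒯.mu M, ∀ g : 𝒯.G, cf M g ^ 𝔗.l = CycEnvelope.coboundary (MonoidHom.id 𝒯.G) (𝒯.chi M) d g)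
    (hγμχ : ∀ (M : E) (x : 𝒯.PiX) (t : 𝒯.mu M), γμ M (𝒯.chi M (𝒯.aug x) t) = 𝒯.chi M (𝒯.aug (γ x)) (γμ M t))
    (hγμred : ∀ (M M' : E) (h : (M : ℕ+) ∣ M') (t : 𝒯.mu M'), 𝒯.red M M' h (γμ M' t) = γμ M (𝒯.red M M' h t))
    (haug : ∀ x y : 𝒯.PiX, 𝒯.aug x = 𝒯.aug y → 𝒯.aug (γ x) = 𝒯.aug (γ y))
    (hinfη : ∀ (M : E) (k k' : 𝒯.PiYdd), 𝒯.aug k = 𝒯.aug k' →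
      (η M k)⁻¹ * γμ M (η M ⟨γ.symm k, 𝒯.symm_apply_mem_PiYdd_of_map_eq γ hγ k k.2⟩) =
        (η M k')⁻¹ * γμ M (η M ⟨γ.symm k', 𝒯.symm_apply_mem_PiYdd_of_map_eq γ hγ k' k'.2⟩))
    (hsep : ∀ η' : ∀ M : E, 𝒯.PiYdd → 𝒯.mu M, (∀ M, η' M ∈ 𝒯.thetaCocycles M) →
      (∀ (M M' : E) (h : (M : ℕ+) ∣ M'), 𝒯.red M M' h ∘ η' M' = η' M) →
      (∀ (M : E) (k k' : 𝒯.PiYdd), 𝒯.aug k = 𝒯.aug k' → η' M k * (η M k)⁻¹ = η' M k' * (η M k')⁻¹) →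
      ∀ M : E, ∃ d : 𝒯.mu M, ∀ k : 𝒯.PiYdd,
        (η' M k * (η M k)⁻¹) ^ 2 = CycEnvelope.coboundary (𝒯.aug.comp 𝒯.PiYdd.subtype) (𝒯.chi M) d k)
    -- Thm. 5.6 at each family member, quantified exactly like `htorsfam`
    (hK4fam : ∀ (α₁ : Ψ.functor.obj (𝔗.AN 1) ≅ 𝔗.AN 1) (β₁ : Ψ.functor.obj (𝔗.BN 1) ≅ 𝔗.BN 1) (u₁ : Aut (𝔗.BN 1))
      (hu₁ : u₁ ∈ (𝔗.atLevel 1).units (𝔗.BN 1)),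
      α₁.inv ≫ Ψ.functor.map (𝔗.sCap 1) ≫ β₁.hom = 𝔗.sCap 1 →
      α₁.inv ≫ Ψ.functor.map (𝔗.sCup 1) ≫ β₁.hom = 𝔗.sCup 1 ≫ u₁.hom →
      ∀ c : 𝔗.Kˣ, (𝔗.atLevel 1).unitsToBirat (𝔗.BN 1) ⟨u₁, hu₁⟩ = 𝔗.constEmb 1 c →
      ∀ N (hN : N ∈ E), ∀ (a : Ψ.functor.obj (𝔗.AN N) ≅ 𝔗.AN N) (b : Ψ.functor.obj (𝔗.BN N) ≅ 𝔗.BN N) (w : Aut (𝔗.BN N)),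
        w ∈ (𝔗.atLevel N).units (𝔗.BN N) →
        a.inv ≫ Ψ.functor.map (𝔗.sCap N) ≫ b.hom = 𝔗.sCap N →
        a.inv ≫ Ψ.functor.map (𝔗.sCup N) ≫ b.hom = 𝔗.sCup N ≫ w.hom →
        a.inv ≫ Ψ.functor.map (𝔗.α (one_dvd_level N)) ≫ α₁.hom = 𝔗.α (one_dvd_level N) →
        b.inv ≫ Ψ.functor.map (𝔗.β (one_dvd_level N)) ≫ β₁.hom = 𝔗.β (one_dvd_level N) →
          ∃ θb : Aut (𝔗.pre.base.obj (𝔗.BN N)) ≃* Aut (𝔗.pre.base.obj (𝔗.BN N)),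
            (𝔗.atLevel N).HB.map θb.toMonoidHom = (𝔗.atLevel N).HB ∧
            (𝔗.atLevel N).StrvTransport Ψ a (Iso.refl _) θb ∧
            (∀ k : 𝔗.PiYdd, θb (𝔗.ρ N k) = 𝔗.ρ N (ι.symm (γ (ι k)))) ∧
            ∀ x : 𝒯.mu ⟨N, hN⟩, (𝔗.atLevel N).psiAut Ψ b
                (((m ⟨N, hN⟩).symm x : (𝔗.atLevel N).muTorsion (𝔗.atLevel N).BN (𝔗.atLevel N).N) : Aut (𝔗.atLevel N).BN) =
              (((m ⟨N, hN⟩).symm (γμ ⟨N, hN⟩ x) : (𝔗.atLevel N).muTorsion (𝔗.atLevel N).BN (𝔗.atLevel N).N) :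
                Aut (𝔗.atLevel N).BN)) :
    ∀ (α₁ : Ψ.functor.obj (𝔗.AN 1) ≅ 𝔗.AN 1) (β₁ : Ψ.functor.obj (𝔗.BN 1) ≅ 𝔗.BN 1) (u₁ : Aut (𝔗.BN 1))
      (hu₁ : u₁ ∈ (𝔗.atLevel 1).units (𝔗.BN 1)),
      α₁.inv ≫ Ψ.functor.map (𝔗.sCap 1) ≫ β₁.hom = 𝔗.sCap 1 →
      α₁.inv ≫ Ψ.functor.map (𝔗.sCup 1) ≫ β₁.hom = 𝔗.sCup 1 ≫ u₁.hom →
      ∀ c : 𝔗.Kˣ, (𝔗.atLevel 1).unitsToBirat (𝔗.BN 1) ⟨u₁, hu₁⟩ = 𝔗.constEmb 1 c →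
      ∀ N ∈ E, ∀ (a : Ψ.functor.obj (𝔗.AN N) ≅ 𝔗.AN N) (b : Ψ.functor.obj (𝔗.BN N) ≅ 𝔗.BN N) (w : Aut (𝔗.BN N)),
        w ∈ (𝔗.atLevel N).units (𝔗.BN N) →
        a.inv ≫ Ψ.functor.map (𝔗.sCap N) ≫ b.hom = 𝔗.sCap N →
        a.inv ≫ Ψ.functor.map (𝔗.sCup N) ≫ b.hom = 𝔗.sCup N ≫ w.hom →
        a.inv ≫ Ψ.functor.map (𝔗.α (one_dvd_level N)) ≫ α₁.hom = 𝔗.α (one_dvd_level N) →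
        b.inv ≫ Ψ.functor.map (𝔗.β (one_dvd_level N)) ≫ β₁.hom = 𝔗.β (one_dvd_level N) →
          ∃ u ∈ (𝔗.atLevel N).muTorsion (𝔗.BN N) N, ∀ k : (𝔗.atLevel N).PiYdd,
            𝔗.sgpCup N ((𝔗.atLevel N).rhoYdd k) * w ^ (2 * 𝔗.l) * (𝔗.sgpCup N ((𝔗.atLevel N).rhoYdd k))⁻¹ * (w ^ (2 * 𝔗.l))⁻¹ =
              𝔗.sgpCup N ((𝔗.atLevel N).rhoYdd k) * u * (𝔗.sgpCup N ((𝔗.atLevel N).rhoYdd k))⁻¹ * u⁻¹ := by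
  intro α₁ β₁ u₁ hu₁ h₁ h₂ c hc N hN a b w hw hTa hTb hΨa hΨb
  have hTr : a.inv ≫ Ψ.functor.map (𝔗.sCap N) ≫ b.hom = (Iso.refl (𝔗.AN N)).hom ≫ 𝔗.sCap N ≫ (1 : Aut (𝔗.BN N)).hom := by
    rw [hTa, Iso.refl_hom, Category.id_comp]
    show 𝔗.sCap N = 𝔗.sCap N ≫ (Iso.refl (𝔗.BN N)).hom
    rw [Iso.refl_hom, Category.comp_id]
  have hTr' : a.inv ≫ Ψ.functor.map (𝔗.sCup N) ≫ b.hom = (Iso.refl (𝔗.AN N)).hom ≫ 𝔗.sCup N ≫ w.hom := by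
    rw [hTb, Iso.refl_hom, Category.id_comp]
  exact (hK4fam α₁ β₁ u₁ hu₁ h₁ h₂ c hc N hN a b w hw hTa hTb hΨa hΨb).elim fun θb hθ =>
    𝔗.kummerTorsion_of_etaleTower Ψ 𝒯 ι hι m hχ H η hη hηc hpin γ hγ hγ' γμ hstd hγμχ hγμred haug hinfη hsep hN a b (Iso.refl _) w
      θb hθ.1 hTr hTr' hθ.2.1 hw hθ.2.2.1 hθ.2.2.2

end FamilyGeneric

end ThetaFrobenioidTower

end Literature.AnabelianGeometry.EtaleTheta
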